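import Mathlib
import HarnessLib
import Summits.ValiantsHypothesis.ValiantsHypothesis.Theorems.EquivariantDialLeVerrier
import Summits.ValiantsHypothesis.ValiantsHypothesis.Theorems.EquivariantDialLayersGraded

/-!
# Equivariant-dc dial: LE VERRIER'S LAYERED PROGRAM — from block-gauge data `[[ℓ, r], [c, 1 + Z]]` of a form of
# degree `d + 2`, a homogeneous layered program with `d + 2` edge layers on the vertex set `n × n ⊔ n ⊔ ⋆`
# computing the form (decomp-valiant workshop, lens 1, generation 16) — support file of census cell A; NOT a route

HONEST FRAMING.  `VP ≠ VNP` is NOT proved here and nothing in this file is progress on it.  Sorry-free SUPPORT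
file of the census cell `A = EquivariantDialNode.EqHardBiPerm` (item `stmt-ValiantsHypothesis-23702`): the
PROGRAM half of arrow 2 of Theorem H (`EquivariantDialGrading.GradingCost`; algebra half =
`EquivariantDialLeVerrier`, arrow 3 = `EquivariantDialLayersGraded`).  Kernel-checked, no `sorry`, no axioms:
* §1 `LayeredABPOn V`: the tree's homogeneous layered programs ([Nisan1991Noncommutative, §2]) on an ARBITRARY
  finite vertex type `V` with exact layerwise lifts (`Lift`), and the reindexing `toLayered` along `V ≃ Fin w` to
  the tree's `LayeredABP` preserving the computed polynomial (`eval_toLayered`) and transporting lifts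
  (`Lift.toLayered`); hence `hasLayeredWidthLE_of_lifts`.
* §2 BLOCK-GAUGE data `BlockGauge` (`Z, c, r, ℓ` linear) and LE VERRIER'S PROGRAM `BlockGauge.program d` on
  `V = n × n ⊔ (n ⊔ ⋆)`: layers `p < d` execute `N ↦ (tr(Z N)/(p+1)) · 1 − Z N` on the `n × n` block (edge labels
  `± const · Z_{ab}`), layer `d` collects `N_d c` on `n` and `E_{d+1} = tr(Z N_d)/(d+1)` on `⋆`, layer `d + 1`
  closes with `ℓ` and `−r` [Csanky1976; Berkowitz1984 §2].
* §3 CORRECTNESS (`BlockGauge.eval_program`, characteristic `0`): the program computes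
  `ℓ · E_{d+1}(Z) − r ⬝ (N_d(Z) c)` (layer by layer from `lvN_zero`, `lvN_succ`, `lvE_succ`); with the graded Schur
  complement `eq_schur_top_of_det_border` this is the represented form `f` (`BlockGauge.hasLayeredWidthLE_of_lifts`:
  lifts of the program on `Γ` ⟹ `HasLayeredWidthLE Γ f (d + 2) |V|`, `|V| = n² + n + 1`).
The LIFTS of the program from block-gauge lift data `(M, α, β)` are the next file.  Census reading: no new cell,
no tag change.  No `instance`, no `notation`; nothing from `Literature` is restated.
-/

set_option linter.dupNamespace false

namespace Summit.ValiantsHypothesis.ValiantsHypothesis.Theorems.EquivariantDialLayers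

open MvPolynomial Matrix Literature.Computability.AlgebraicComplexity

noncomputable section

/-! ## §1 Layered programs on an arbitrary finite vertex type -/

/-- The data of `LayeredABP` with every vertex layer an arbitrary (finite) type `V`. -/
structure LayeredABPOn (V : Type*) (σ : Type*) (k : Type*) [CommRing k] (L : ℕ) where
  /-- transition matrix of linear forms between vertex layers `t` and `t + 1` -/
  T : Fin L → Matrix V V (MvPolynomial σ k)
  /-- source weights -/
  u : V → k
  /-- sink weights -/
  v : V → k
  /-- every edge label is a linear form -/
  linear : ∀ t a b, (T t a b).IsHomogeneous 1

namespace LayeredABPOn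

variable {V : Type*} [Fintype V] [DecidableEq V] {σ : Type*} {k : Type*} [CommRing k] {L : ℕ}

/-- The product of all transition matrices. -/
def prodT (P : LayeredABPOn V σ k L) : Matrix V V (MvPolynomial σ k) := (List.ofFn P.T).prod

/-- The computed polynomial `uᵀ (T 0 ⋯ T (L-1)) v`. -/
def eval (P : LayeredABPOn V σ k L) : MvPolynomial σ k :=
  (fun a => C (P.u a)) ⬝ᵥ (P.prodT *ᵥ fun b => C (P.v b))

section Reindex

variable (P : LayeredABPOn V σ k L) {w : ℕ} (e : V ≃ Fin w)

/-- Reindex the vertex layers along `e : V ≃ Fin w` to obtain a `LayeredABP` of width `w`. -/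
def toLayered : LayeredABP σ k L w where
  T t := (P.T t).submatrix e.symm e.symm
  u := P.u ∘ e.symm
  v := P.v ∘ e.symm
  linear t i j := P.linear t (e.symm i) (e.symm j)

/-- Reindexing commutes with products of lists of matrices. -/
theorem list_prod_submatrix (l : List (Matrix V V (MvPolynomial σ k))) :
    (l.map fun A => A.submatrix e.symm e.symm).prod = l.prod.submatrix e.symm e.symm := by
  induction l with
  | nil => simp [Matrix.submatrix_one_equiv]
  | cons A l ih => rw [List.map_cons, List.prod_cons, List.prod_cons, ih, ← Matrix.submatrix_mul_equiv A l.prod e.symm e.symm e.symm]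

/-- The product of the reindexed program is the reindexed product. -/
theorem prodT_toLayered : (P.toLayered e).prodT = P.prodT.submatrix e.symm e.symm := by
  rw [LayeredABP.prodT, prodT, ← list_prod_submatrix, List.map_ofFn]
  rfl

/-- Reindexing preserves the computed polynomial. -/
theorem eval_toLayered : (P.toLayered e).eval = P.eval := by
  rw [LayeredABP.eval, prodT_toLayered, Matrix.submatrix_mulVec_equiv]
  have hv : ((fun j => (C ((P.toLayered e).v j) : MvPolynomial σ k)) ∘ e.symm.symm) =
      fun b => (C (P.v b) : MvPolynomial σ k) := by
    funext b; simp [toLayered]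
  rw [hv]
  exact e.symm.sum_comp (fun b => (C (P.u b) : MvPolynomial σ k) * (P.prodT *ᵥ fun b => C (P.v b)) b)

end Reindex

variable [Fintype σ] [DecidableEq σ]

/-- An exact layerwise lift of `γ ∈ GL(σ)` (as in `LayeredABP.Lift`, on the vertex type `V`). -/
structure Lift (P : LayeredABPOn V σ k L) (γ : GL σ k) where
  /-- the lift on vertex layer `t` -/
  R : Fin (L + 1) → GL V k
  /-- eigenvalue of the source vector -/
  a : kˣ
  /-- eigenvalue of the sink vector -/
  b : kˣ
  layer : ∀ t : Fin L, Matrix.linSubstEntries γ (P.T t) =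
    ((R t.castSucc : GL V k) : Matrix V V k).map C * P.T t * (((R t.succ)⁻¹ : GL V k) : Matrix V V k).map C
  src : P.u ᵥ* ((R 0 : GL V k) : Matrix V V k) = (a : k) • P.u
  snk : ((R (Fin.last L) : GL V k) : Matrix V V k) *ᵥ P.v = (b : k) • P.v

/-- Lifts are transported along the reindexing. -/
def Lift.toLayered {P : LayeredABPOn V σ k L} {γ : GL σ k} (Λ : P.Lift γ) {w : ℕ} (e : V ≃ Fin w) :
    (P.toLayered e).Lift γ where
  R t := LayeredABP.glReindex e (Λ.R t)
  a := Λ.a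
  b := Λ.b
  layer t := by
    show Matrix.linSubstEntries γ ((P.T t).submatrix e.symm e.symm) =
      (((Λ.R t.castSucc : GL V k) : Matrix V V k).submatrix e.symm e.symm).map C *
        (P.T t).submatrix e.symm e.symm *
        ((((Λ.R t.succ)⁻¹ : GL V k) : Matrix V V k).submatrix e.symm e.symm).map C
    rw [LayeredABP.linSubstEntries_submatrix_aux, Λ.layer t, ← Matrix.submatrix_map, ← Matrix.submatrix_map,
      Matrix.submatrix_mul_equiv, Matrix.submatrix_mul_equiv]
  src := by
    show (P.u ∘ e.symm) ᵥ* ((Λ.R 0 : GL V k) : Matrix V V k).submatrix e.symm e.symm = (Λ.a : k) • (P.u ∘ e.symm)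
    rw [Matrix.submatrix_vecMul_equiv]
    have h1 : ((P.u ∘ e.symm) ∘ e.symm.symm) = P.u := by funext b; simp
    rw [h1, Λ.src]
    rfl
  snk := by
    show ((Λ.R (Fin.last L) : GL V k) : Matrix V V k).submatrix e.symm e.symm *ᵥ (P.v ∘ e.symm) =
      (Λ.b : k) • (P.v ∘ e.symm)
    rw [Matrix.submatrix_mulVec_equiv]
    have h1 : ((P.v ∘ e.symm) ∘ e.symm.symm) = P.v := by funext b; simp
    rw [h1, Λ.snk]
    rfl

/-- A program on `V` with lifts on `Γ` witnesses `HasLayeredWidthLE Γ (eval) L |V|`. -/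
theorem hasLayeredWidthLE_of_lifts {Γ : Subgroup (GL σ k)} (P : LayeredABPOn V σ k L)
    (hP : ∀ γ ∈ Γ, Nonempty (P.Lift γ)) : HasLayeredWidthLE Γ P.eval L (Fintype.card V) := by
  refine ⟨P.toLayered (Fintype.equivFin V), fun γ hγ => ?_, P.eval_toLayered _⟩
  obtain ⟨Λ⟩ := hP γ hγ
  exact ⟨Λ.toLayered _⟩

end LayeredABPOn

/-! ## §2 Block-gauge data and Le Verrier's program -/

/-- BLOCK-GAUGE data: the blocks of an affine matrix `[[ℓ, r], [c, 1 + Z]]` with `ℓ, r, c, Z` LINEAR forms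
(constant part `diag(0, 1)`, the corank-one direction first). -/
structure BlockGauge (σ : Type*) (k : Type*) [CommRing k] (n : Type*) where
  /-- the inner block of linear forms -/
  Z : Matrix n n (MvPolynomial σ k)
  /-- the border column -/
  c : n → MvPolynomial σ k
  /-- the border row -/
  r : n → MvPolynomial σ k
  /-- the corner -/
  ℓ : MvPolynomial σ k
  linZ : ∀ i j, (Z i j).IsHomogeneous 1
  linc : ∀ i, (c i).IsHomogeneous 1
  linr : ∀ j, (r j).IsHomogeneous 1
  linℓ : ℓ.IsHomogeneous 1

namespace BlockGauge

variable {σ : Type*} {k : Type*} [Field k] {n : Type*} [Fintype n] [DecidableEq n] (B : BlockGauge σ k n)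

/-- The affine matrix `[[ℓ, r], [c, 1 + Z]]`. -/
def matrix : Matrix (Unit ⊕ n) (Unit ⊕ n) (MvPolynomial σ k) := border B.ℓ B.r B.c B.Z

/-- Le Verrier step `p → p + 1` on the `n × n` block: `N ↦ (tr(Z N)/(p+1)) · 1 − Z N`, as a matrix of
linear forms (row-vector convention: entry `(a, b)` labels the edge from vertex `a` to vertex `b`). -/
def stepBlk (p : ℕ) : Matrix (n × n) (n × n) (MvPolynomial σ k) := fun a b =>
  (if a.2 = b.2 then -B.Z b.1 a.1 else 0) + (if b.1 = b.2 then C ((p + 1 : k)⁻¹) * B.Z a.2 a.1 else 0)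

/-- Layer `d`: collect `N_d c` on the `n` block and `E_{d+1} = tr(Z N_d)/(d+1)` on `⋆`. -/
def collectBlk (d : ℕ) : Matrix (n × n) (n ⊕ Unit) (MvPolynomial σ k) := fun a q =>
  Sum.elim (fun i => if a.1 = i then B.c a.2 else 0) (fun _ => C ((d + 1 : k)⁻¹) * B.Z a.2 a.1) q

/-- Layer `d + 1`: close with `−r` from the `n` block and `ℓ` from `⋆` into the sink `⋆`. -/
def sinkBlk : Matrix (n ⊕ Unit) (n ⊕ Unit) (MvPolynomial σ k) := fun q q' =>
  Sum.elim (fun _ => 0) (fun _ => Sum.elim (fun i => -B.r i) (fun _ => B.ℓ) q) q'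

/-- The transition matrix of edge layer `p` of the program of length `d + 2`. -/
def layerM (d p : ℕ) : Matrix ((n × n) ⊕ (n ⊕ Unit)) ((n × n) ⊕ (n ⊕ Unit)) (MvPolynomial σ k) :=
  if p < d then fromBlocks (B.stepBlk p) 0 0 0
  else if p = d then fromBlocks 0 (B.collectBlk d) 0 0 else fromBlocks 0 0 0 B.sinkBlk

variable (k n) in
/-- Source weights: the identity matrix on the `n × n` block (`N_0 = 1`). -/
def srcVec : (n × n) ⊕ (n ⊕ Unit) → k := Sum.elim (fun a => if a.1 = a.2 then 1 else 0) 0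

variable (k n) in
/-- Sink weights: the vertex `⋆`. -/
def snkVec : (n × n) ⊕ (n ⊕ Unit) → k := Sum.elim 0 (Sum.elim 0 fun _ => 1)

omit [Fintype n] in
/-- The Le Verrier step has linear entries. -/
theorem isHomogeneous_stepBlk (p : ℕ) (a b : n × n) : (B.stepBlk p a b).IsHomogeneous 1 := by
  unfold stepBlk
  refine IsHomogeneous.add ?_ ?_
  · split_ifs
    exacts [(B.linZ _ _).neg, isHomogeneous_zero _ _ _]
  · split_ifs
    exacts [(B.linZ _ _).C_mul _, isHomogeneous_zero _ _ _]

omit [Fintype n] in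
/-- The collecting layer has linear entries. -/
theorem isHomogeneous_collectBlk (d : ℕ) (a : n × n) (q : n ⊕ Unit) : (B.collectBlk d a q).IsHomogeneous 1 := by
  rcases q with i | u
  · simp only [collectBlk, Sum.elim_inl]
    split_ifs
    exacts [B.linc _, isHomogeneous_zero _ _ _]
  · exact (B.linZ _ _).C_mul _

omit [Fintype n] [DecidableEq n] in
/-- The closing layer has linear entries. -/
theorem isHomogeneous_sinkBlk (q q' : n ⊕ Unit) : (B.sinkBlk q q').IsHomogeneous 1 := by
  rcases q' with i | u
  · exact isHomogeneous_zero _ _ _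
  · rcases q with j | u'
    exacts [(B.linr _).neg, B.linℓ]

omit [Fintype n] in
/-- Every layer has linear entries. -/
theorem isHomogeneous_layerM (d p : ℕ) (a b : (n × n) ⊕ (n ⊕ Unit)) : (B.layerM d p a b).IsHomogeneous 1 := by
  unfold layerM
  split_ifs <;> rcases a with a | q <;> rcases b with b | q' <;>
    simp only [fromBlocks_apply₁₁, fromBlocks_apply₁₂, fromBlocks_apply₂₁, fromBlocks_apply₂₂,
      Matrix.zero_apply] <;>
    first
    | exact isHomogeneous_zero _ _ _
    | exact B.isHomogeneous_stepBlk _ _ _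
    | exact B.isHomogeneous_collectBlk _ _ _
    | exact B.isHomogeneous_sinkBlk _ _

/-- **Le Verrier's program** of length `d + 2` on the vertex type `n × n ⊔ (n ⊔ ⋆)`. -/
def program (d : ℕ) : LayeredABPOn ((n × n) ⊕ (n ⊕ Unit)) σ k (d + 2) where
  T t := B.layerM d t.val
  u := srcVec k n
  v := snkVec k n
  linear t a b := B.isHomogeneous_layerM d t.val a b

/-! ## §3 Correctness: the program computes `ℓ · E_{d+1} − r ⬝ (N_d c)` -/

section Eval

variable (d : ℕ)

/-- Prefix products of the layers. -/
def pre (p : ℕ) : Matrix ((n × n) ⊕ (n ⊕ Unit)) ((n × n) ⊕ (n ⊕ Unit)) (MvPolynomial σ k) :=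
  ((List.range p).map (B.layerM d)).prod

/-- The row vector reaching vertex layer `p`. -/
def row (p : ℕ) : (n × n) ⊕ (n ⊕ Unit) → MvPolynomial σ k := (fun a => C (srcVec k n a)) ᵥ* B.pre d p

omit [Fintype n] [DecidableEq n] B in
/-- `List.ofFn` over `Fin L` of a function of the value is `List.map` over `List.range L`. -/
theorem ofFn_val_eq_map {α : Type*} (g : ℕ → α) :
    ∀ L : ℕ, List.ofFn (fun t : Fin L => g t.val) = (List.range L).map g
  | 0 => by simp
  | L + 1 => by
      rw [List.ofFn_succ', List.concat_eq_append, List.range_succ, List.map_append]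
      simp only [Fin.val_castSucc, Fin.val_last, List.map_cons, List.map_nil]
      rw [ofFn_val_eq_map g L]

/-- The full product of the program is the last prefix product. -/
theorem prodT_program : (B.program d).prodT = B.pre d (d + 2) := by
  rw [LayeredABPOn.prodT, pre, ← ofFn_val_eq_map]
  rfl

/-- Prefix products grow by one layer. -/
theorem pre_succ (p : ℕ) : B.pre d (p + 1) = B.pre d p * B.layerM d p := by
  simp [pre, List.range_succ, List.map_append, List.prod_append]

/-- Rows propagate through the layers. -/
theorem row_succ (p : ℕ) : B.row d (p + 1) = B.row d p ᵥ* B.layerM d p := by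
  rw [row, pre_succ, ← Matrix.vecMul_vecMul]
  rfl

/-- Row `0` is `N_0 = 1` on the `n × n` block. -/
theorem row_zero : B.row d 0 = Sum.elim (fun a => lvN B.Z 0 a.1 a.2) (0 : n ⊕ Unit → MvPolynomial σ k) := by
  have h0 : B.pre d 0 = 1 := by simp [pre]
  rw [row, h0, Matrix.vecMul_one, lvN_zero]
  funext x
  rcases x with a | q
  · simp [srcVec, Matrix.one_apply, apply_ite C]
  · simp [srcVec]

omit [DecidableEq n] in
/-- The sum `Σ_{a} N_{a₁a₂} · (κ Z_{a₂a₁}) = κ · tr(Z N)`. -/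
theorem sum_mul_C_mul_Z (N : Matrix n n (MvPolynomial σ k)) (κ : MvPolynomial σ k) :
    ∑ a : n × n, N a.1 a.2 * (κ * B.Z a.2 a.1) = κ * (B.Z * N).trace := by
  simp only [Matrix.trace, Matrix.diag, Matrix.mul_apply, Finset.mul_sum, Fintype.sum_prod_type]
  rw [Finset.sum_comm]
  exact Finset.sum_congr rfl fun j _ => Finset.sum_congr rfl fun i _ => by ring

/-- The Le Verrier step acts on the `n × n` block as `N ↦ κ tr(Z N) · 1 − Z N`. -/
theorem pair_vecMul_stepBlk (N : Matrix n n (MvPolynomial σ k)) (p : ℕ) (b : n × n) :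
    ((fun a : n × n => N a.1 a.2) ᵥ* B.stepBlk p) b =
      (if b.1 = b.2 then C ((p + 1 : k)⁻¹) * (B.Z * N).trace else 0) - (B.Z * N) b.1 b.2 := by
  have hA : ∑ a : n × n, N a.1 a.2 * (if a.2 = b.2 then -B.Z b.1 a.1 else 0) = -(B.Z * N) b.1 b.2 := by
    simp only [mul_ite, mul_zero, Fintype.sum_prod_type, Finset.sum_ite_eq', Finset.mem_univ, if_true,
      Matrix.mul_apply, ← Finset.sum_neg_distrib]
    exact Finset.sum_congr rfl fun i _ => by ring
  have hB : ∑ a : n × n, N a.1 a.2 * (if b.1 = b.2 then C ((p + 1 : k)⁻¹) * B.Z a.2 a.1 else 0) =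
      if b.1 = b.2 then C ((p + 1 : k)⁻¹) * (B.Z * N).trace else 0 := by
    split_ifs
    · exact B.sum_mul_C_mul_Z N _
    · simp
  simp only [Matrix.vecMul, dotProduct, stepBlk, mul_add, Finset.sum_add_distrib, hA, hB]
  ring

variable [CharZero k]

/-- `tr(Z N_p)/(p+1) = E_{p+1}` (Le Verrier's trace half, solved for `E_{p+1}` in characteristic `0`). -/
theorem C_inv_mul_trace (p : ℕ) : C ((p + 1 : k)⁻¹) * (B.Z * lvN B.Z p).trace = lvE B.Z (p + 1) := by
  have hp : ((p : MvPolynomial σ k) + 1) = C ((p : k) + 1) := by rw [map_add, map_natCast, map_one]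
  rw [← lvE_succ, hp, mul_comm, mul_assoc, ← map_mul, mul_inv_cancel₀ (Nat.cast_add_one_ne_zero p),
    map_one, mul_one]

/-- Rows `p ≤ d` carry `N_p` on the `n × n` block (and nothing elsewhere). -/
theorem row_pair (p : ℕ) (hp : p ≤ d) :
    B.row d p = Sum.elim (fun a => lvN B.Z p a.1 a.2) (0 : n ⊕ Unit → MvPolynomial σ k) := by
  induction p with
  | zero => exact B.row_zero d
  | succ p ih =>
    rw [row_succ, ih (by omega), layerM, if_pos (by omega : p < d), Matrix.vecMul_fromBlocks]
    simp only [Sum.elim_comp_inl, Sum.elim_comp_inr, Matrix.vecMul_zero, add_zero]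
    congr 1
    funext b
    rw [pair_vecMul_stepBlk, C_inv_mul_trace, lvN_succ, Matrix.sub_apply, Matrix.smul_apply, Matrix.one_apply,
      smul_eq_mul, mul_ite, mul_one, mul_zero]

/-- Row `d + 1` carries `N_d c` on the `n` block and `E_{d+1}` on `⋆`. -/
theorem row_collect :
    B.row d (d + 1) =
      Sum.elim (0 : n × n → MvPolynomial σ k) (Sum.elim (fun i => (lvN B.Z d *ᵥ B.c) i) (fun _ => lvE B.Z (d + 1))) := by
  rw [row_succ, B.row_pair d d le_rfl, layerM, if_neg (lt_irrefl d), if_pos rfl, Matrix.vecMul_fromBlocks]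
  simp only [Sum.elim_comp_inl, Sum.elim_comp_inr, Matrix.vecMul_zero, add_zero]
  congr 1
  funext q
  rcases q with i | u
  · simp only [Matrix.vecMul, dotProduct, collectBlk, Sum.elim_inl, mul_ite, mul_zero, Fintype.sum_prod_type,
      Finset.sum_ite_irrel, Finset.sum_const_zero, Finset.sum_ite_eq', Finset.mem_univ, if_true,
      Matrix.mulVec]
  · simp only [Matrix.vecMul, dotProduct, collectBlk, Sum.elim_inr]
    exact (B.sum_mul_C_mul_Z _ _).trans (B.C_inv_mul_trace d)

/-- Row `d + 2` carries the value `ℓ · E_{d+1} − r ⬝ (N_d c)` on `⋆` (and nothing elsewhere). -/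
theorem row_sink : B.row d (d + 2) = Sum.elim (0 : n × n → MvPolynomial σ k)
    (Sum.elim (0 : n → MvPolynomial σ k) fun _ => B.ℓ * lvE B.Z (d + 1) - B.r ⬝ᵥ (lvN B.Z d *ᵥ B.c)) := by
  rw [row_succ, row_collect, layerM, if_neg (by omega), if_neg (by omega), Matrix.vecMul_fromBlocks]
  simp only [Sum.elim_comp_inl, Sum.elim_comp_inr, Matrix.vecMul_zero, zero_add]
  congr 1
  funext q'
  rcases q' with i | u
  · simp [Matrix.vecMul, dotProduct, sinkBlk]
  · simp only [Matrix.vecMul, dotProduct, sinkBlk, Sum.elim_inl, Sum.elim_inr, Fintype.sum_sum_type,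
      Finset.univ_unique, Finset.sum_singleton, mul_neg, Finset.sum_neg_distrib]
    have hc : ∑ i, (lvN B.Z d *ᵥ B.c) i * B.r i = ∑ i, B.r i * (lvN B.Z d *ᵥ B.c) i :=
      Finset.sum_congr rfl fun i _ => mul_comm _ _
    rw [hc]
    ring

/-- **CORRECTNESS.**  Le Verrier's program computes `ℓ · E_{d+1}(Z) − r ⬝ (N_d(Z) c)`. -/
theorem eval_program : (B.program d).eval = B.ℓ * lvE B.Z (d + 1) - B.r ⬝ᵥ (lvN B.Z d *ᵥ B.c) := by
  rw [LayeredABPOn.eval, prodT_program, Matrix.dotProduct_mulVec]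
  change B.row d (d + 2) ⬝ᵥ (fun b => C ((B.program d).v b)) = _
  have hv : (fun b => C ((B.program d).v b)) = Sum.elim (0 : n × n → MvPolynomial σ k)
      (Sum.elim (0 : n → MvPolynomial σ k) fun _ : Unit => (1 : MvPolynomial σ k)) := by
    funext b
    rcases b with a | (i | u) <;> simp [program, snkVec]
  rw [row_sink, hv, sumElim_dotProduct_sumElim, sumElim_dotProduct_sumElim]
  simp [dotProduct]

/-- **Arrow 2 of Theorem H, given lifts.**  If the program has exact layerwise lifts on `Γ` and
`det [[ℓ, r], [c, 1 + Z]] = f` with `f` a form of degree `d + 2`, then `f` has `Γ`-equivariant layered width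
`≤ |n × n ⊔ n ⊔ ⋆|` in length `d + 2`. -/
theorem hasLayeredWidthLE_of_lifts [Fintype σ] [DecidableEq σ] {Γ : Subgroup (GL σ k)}
    (hB : ∀ γ ∈ Γ, Nonempty ((B.program d).Lift γ)) {f : MvPolynomial σ k} (hf : f.IsHomogeneous (d + 2))
    (hdet : B.matrix.det = f) :
    HasLayeredWidthLE Γ f (d + 2) (Fintype.card ((n × n) ⊕ (n ⊕ Unit))) := by
  have h := (B.program d).hasLayeredWidthLE_of_lifts hB
  rw [eval_program] at h
  have hf' : f = B.ℓ * lvE B.Z (d + 1) - B.r ⬝ᵥ (lvN B.Z d *ᵥ B.c) :=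
    eq_schur_top_of_det_border B.linZ B.linr B.linc B.linℓ hf hdet
  rw [hf']
  exact h

end Eval

end BlockGauge

end

end Summit.ValiantsHypothesis.ValiantsHypothesis.Theorems.EquivariantDialLayers
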